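import Summits.Ventures.PercRepro.C041RcPortCountGen

/-!
# THEOREM R without side conditions, and the colourings whose terminal-adjacent zones are all rc (p6, gen 24)

Setting of `C041RcPortCountGen`.  The side conditions of the count are removed: if the probe is a terminal or the
terminals coincide there is no source at all (`ne_of_rcSrc`); if the probe is adjacent to a terminal, every source
has a Good side through that (red) edge and weight `≥ 1` (`one_le_gdWeight_of_adj`, mine-3's «otherwise every
source has `g ≥ 1` and `(G⅔)` is trivial»).  Hence **`rc_theoremR`**: on EVERY skeleton,
`0 ≤ Σ_{S ∈ rcSrcAll} (3·[Good_a S] + 3·[Good_b S] − 2)` — mine-3's THEOREM R (ROW C-041 `(G⅔)` on the sources all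
of whose attached zones are internally red-connected), no hypothesis.  And the base case of mine-3's (O-CUBE)
(C-041.md §5): when every zone of `O` carrying a terminal edge is rc (in particular when every such zone is a
singleton, `B(O) = ∅`), every source with bare colouring `O` is an rc source, so `F(O) ≥ 0`
(**`sum_goodDegree_nonneg_of_rc_zones`**).
-/

namespace PercRepro

namespace MultiGraph

open Finset ZonePort

variable {V E : Type*} {G : MultiGraph V E}

section TheoremR

variable [Fintype V] [Fintype E] [DecidableEq E] (a b c : V)

open Classical in
/-- The Good-degree weight of a configuration. -/
noncomputable def gdWeight (G : MultiGraph V E) (a b c : V) (S : Config E) : ℤ :=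
  (if G.WalkAvoiding S (G.cluster Sᶜ a) c b then (3 : ℤ) else 0) +
    (if G.WalkAvoiding S (G.cluster Sᶜ b) c a then 3 else 0) - 2

omit [Fintype V] [Fintype E] [DecidableEq E] in
/-- A source with the probe adjacent to a terminal has a Good side: the edge is red and gives the walk. -/
theorem good_of_adj {S : Config E} (hS : (G.Conn S c a ∧ G.Conn S c b) ∧
    (¬ G.Conn Sᶜ c a ∧ ¬ G.Conn Sᶜ c b ∧ ¬ G.Conn Sᶜ a b)) (hadj : ∃ e, G.Joins e c a ∨ G.Joins e c b) :
    G.WalkAvoiding S (G.cluster Sᶜ a) c b ∨ G.WalkAvoiding S (G.cluster Sᶜ b) c a := by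
  obtain ⟨_, hca', hcb', hab'⟩ := hS
  obtain ⟨e, he⟩ := hadj
  have hred : S e = true := by
    cases h : S e
    · exfalso
      rcases he with he | he
      · exact hca' (Conn.of_openAdj ⟨e, by rw [compl_apply_not, h]; rfl, he⟩)
      · exact hcb' (Conn.of_openAdj ⟨e, by rw [compl_apply_not, h]; rfl, he⟩)
    · rfl
  rcases he with he | he
  · -- the red edge `c–a` avoids the blue cluster of `b`
    right
    refine ⟨fun h => hcb' ((G.mem_cluster).1 h).symm, Relation.ReflTransGen.single ⟨⟨e, hred, he⟩, ?_⟩⟩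
    exact fun h => hab' ((G.mem_cluster).1 h).symm
  · left
    refine ⟨fun h => hca' ((G.mem_cluster).1 h).symm, Relation.ReflTransGen.single ⟨⟨e, hred, he⟩, ?_⟩⟩
    exact fun h => hab' ((G.mem_cluster).1 h)

omit [Fintype V] [Fintype E] [DecidableEq E] in
open Classical in
/-- With the probe adjacent to a terminal every source has weight `≥ 1`. -/
theorem one_le_gdWeight_of_adj {S : Config E} (hS : (G.Conn S c a ∧ G.Conn S c b) ∧
    (¬ G.Conn Sᶜ c a ∧ ¬ G.Conn Sᶜ c b ∧ ¬ G.Conn Sᶜ a b)) (hadj : ∃ e, G.Joins e c a ∨ G.Joins e c b) :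
    1 ≤ G.gdWeight a b c S := by
  unfold gdWeight
  rcases good_of_adj a b c hS hadj with h | h
  · rw [if_pos h]
    split_ifs <;> omega
  · rw [if_pos h]
    split_ifs <;> omega

omit [Fintype E] [DecidableEq E] in
/-- A source has distinct marks. -/
theorem ne_of_rcSrc {O S : Config E} (hS : G.IsRcSrc a b c O S) : c ≠ a ∧ c ≠ b ∧ a ≠ b := by
  obtain ⟨_, _, _, hca', hcb', hab'⟩ := hS
  refine ⟨fun h => hca' (h ▸ Conn.refl G _ c), fun h => hcb' (h ▸ Conn.refl G _ c),
    fun h => hab' (h ▸ Conn.refl G _ a)⟩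

open Classical in
/-- **THEOREM R on every skeleton** (mine-3, C-041.md §3): ROW C-041 `(G⅔)` restricted to the sources all of whose
attached zones are internally red-connected, `0 ≤ Σ_{S ∈ rcSrcAll} (3·[Good_a S] + 3·[Good_b S] − 2)`, with no
hypothesis on the skeleton. -/
theorem rc_theoremR : 0 ≤ ∑ S ∈ G.rcSrcAll a b c, G.gdWeight a b c S := by
  by_cases hadj : ∃ e, G.Joins e c a ∨ G.Joins e c b
  · -- every source has weight `≥ 1`
    apply Finset.sum_nonneg
    intro S hS
    unfold rcSrcAll at hS
    rw [mem_filter] at hS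
    have := one_le_gdWeight_of_adj a b c hS.2.2.2 hadj
    omega
  · by_cases hne : c ≠ a ∧ c ≠ b ∧ a ≠ b
    · have hc : ∀ e, ¬ G.Joins e c a ∧ ¬ G.Joins e c b :=
        fun e => ⟨fun h => hadj ⟨e, Or.inl h⟩, fun h => hadj ⟨e, Or.inr h⟩⟩
      exact sum_goodDegree_nonneg_rc_gen hne.1 hne.2.1 hc hne.2.2
    · -- no source at all
      apply Finset.sum_nonneg
      intro S hS
      exfalso
      unfold rcSrcAll at hS
      rw [mem_filter] at hS
      exact hne (ne_of_rcSrc a b c hS.2)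

/-- The sources with bare colouring `O` (all of them). -/
def IsSrcO (G : MultiGraph V E) (a b c : V) (O S : Config E) : Prop :=
  G.AgreeBare a b O S ∧
    ((G.Conn S c a ∧ G.Conn S c b) ∧ (¬ G.Conn Sᶜ c a ∧ ¬ G.Conn Sᶜ c b ∧ ¬ G.Conn Sᶜ a b))

open Classical in
/-- The sources with bare colouring `O`, as a finite set. -/
noncomputable def srcSetO (G : MultiGraph V E) (a b c : V) (O : Config E) : Finset (Config E) :=
  univ.filter fun S : Config E => G.IsSrcO a b c O S

open Classical in
/-- **When every terminal-adjacent zone of `O` is rc, every source with bare colouring `O` is an rc source.** -/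
theorem srcSetO_eq_rcSrcSet {O : Config E} (hO : ∀ u, (∃ e, G.Joins e u a ∨ G.Joins e u b) → G.Rc a b O u) :
    G.srcSetO a b c O = G.rcSrcSet a b c O := by
  ext S
  unfold srcSetO rcSrcSet IsSrcO IsRcSrc
  simp only [mem_filter, mem_univ, true_and]
  constructor
  · rintro ⟨hagree, hDA⟩
    refine ⟨hagree, fun u hu => hO u ?_, hDA⟩
    rcases hu with ⟨e, hj, _⟩ | ⟨e, hj, _⟩
    · exact ⟨e, Or.inl hj⟩
    · exact ⟨e, Or.inr hj⟩
  · rintro ⟨hagree, _, hDA⟩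
    exact ⟨hagree, hDA⟩

open Classical in
/-- **`F(O) ≥ 0` when every terminal-adjacent zone of `O` is rc** (the base case of mine-3's (O-CUBE), C-041.md
§5; in particular when every such zone is a singleton, `B(O) = ∅`): `0 ≤ Σ_{S source with bare colouring O}
(3·[Good_a S] + 3·[Good_b S] − 2)`, on every skeleton with `c ≠ a, b`, `a ≠ b`. -/
theorem sum_goodDegree_nonneg_of_rc_zones (hca : c ≠ a) (hcb : c ≠ b) (hne : a ≠ b) {O : Config E}
    (hO : ∀ u, (∃ e, G.Joins e u a ∨ G.Joins e u b) → G.Rc a b O u) :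
    0 ≤ ∑ S ∈ G.srcSetO a b c O, G.gdWeight a b c S := by
  rw [srcSetO_eq_rcSrcSet a b c hO]
  by_cases hadj : ∃ e, G.Joins e c a ∨ G.Joins e c b
  · apply Finset.sum_nonneg
    intro S hS
    unfold rcSrcSet at hS
    rw [mem_filter] at hS
    have := one_le_gdWeight_of_adj a b c hS.2.2.2 hadj
    omega
  · have hc : ∀ e, ¬ G.Joins e c a ∧ ¬ G.Joins e c b :=
      fun e => ⟨fun h => hadj ⟨e, Or.inl h⟩, fun h => hadj ⟨e, Or.inr h⟩⟩
    exact sum_goodDegree_nonneg_rc_of_bare_gen hca hcb hc hne O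

end TheoremR

end MultiGraph

end PercRepro
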